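import Summits.AtomisticToContinuum.HydrodynamicLimit.Theses.ImplosionDichotomy
import Summits.AtomisticToContinuum.HydrodynamicLimit.Theorems.DenseExcursion.Negative.Dichotomy
import Summits.AtomisticToContinuum.HydrodynamicLimit.Theorems.DiluteSelfConsistency.Negative.Quantifiers
import Summits.AtomisticToContinuum.HydrodynamicLimit.Theorems.DiluteSelfConsistency.Negative.Tightness
import Summits.AtomisticToContinuum.HydrodynamicLimit.Theorems.ImplosionDichotomyDiluteSelfConsistencyPdeForm
import Literature.Analysis.FunctionSpaces.TorusSpaceTime

/-!
# `DiluteSelfConsistency` (stmt-AtomisticToContinuum-3091) — crux-strategist r1 (RESTATED re-audit bin): BC2-REDIRECT AUDIT, kernel part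

Seat planner-cstrat-stmt-AtomisticToContinuum-3091-r1-0, 2026-08-17. Companion of `STRATEGY-CENSUS.md` §R1 (gen 2).
Question (human ruling 2026-08-16 21:1x CDT, BC2 REDIRECT exemption): is there a typed decomposition `X₁ ∧ … ∧ X_k → DSC`
with (a) k ≥ 2 load-bearing pieces, (b) the assembly PROVED, (c) no piece giving the Statement `S` or the crux `DSC` on its
own (cheap probes fail, no landed iff), (d) every OPEN piece carrying its own registered skeleton or live line?

This file types every candidate that CAN be typed over the tree today, proves every assembly that can be proved, and
exhibits the landed `Iff`s that disqualify two candidates under (c). It is NOT a skeleton (no `stub_*`; nothing here is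
offered to a lead). The per-piece probes of (c) are the files `bc/*.lean` of the seat folder (results quoted in the census).

* §0 the crux is NOT the Statement restated (premise check): `S` neither follows from nor implies `DSC` cheaply
  (probes `bc/P0_parent.lean`); what `DSC` buys `closes` is profile-uniformity of the packing guard, nothing else.
* §A ideal-fate split (landed, exact): `CaseI ∧ CaseII ↔ DSC` — (a)(b)(c) pass, (d) fails on `CaseII` (census).
* §A′ pinning ∧ PDE-form: disqualified under (c) — `DSC_PDE ↔ DSC` is LANDED (`diluteSelfConsistency_iff_pde`).
* §B time split (3 pieces, glue proved here; `PreSingularDiluteness` PROVED from the open support `EosContinuity`):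
  (a)(b)(c) pass, (d) fails on `PostWindowDiluteness` (the crux at the ideal first singularity).
* §E bridge through the sibling: disqualified under (c) — `¬DenseExcursion ↔ DSC` is LANDED.
* §G level bootstrap (bridge `T ∧ (T → DSC)`, `T` = "some level is never reached"): exact, glue trivial; (d) fails.
-/

noncomputable section

namespace Summit.AtomisticToContinuum.HydrodynamicLimit.Cruxes.DiluteSelfConsistency.StrategistR1

open MeasureTheory Filter Set Topology
open Literature.MathematicalPhysics.KineticTheory Literature.Analysis.FluidPDE Literature.Analysis.FunctionSpaces
open Summit.AtomisticToContinuum.HydrodynamicLimit.Theses.ImplosionDichotomy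
open Summit.AtomisticToContinuum.HydrodynamicLimit.Theorems
open Summit.AtomisticToContinuum.HydrodynamicLimit.Theorems.DenseExcursionDichotomy

/-! ## §0 Premise: the crux is not the Statement restated

What `DSC` gives the deciding theorem is profile-uniformity of the packing guard and nothing else:
`closes (hD : DiluteSelfConsistency) (hP : HydroLimitProfilewiseBand) : _root_.HydrodynamicLimit` (route file, rev 11)
consumes the crux at ONE profile-dependent level `η(a₀,θ₀,u₀)`; the crux is not, and does not contain, the LLN
propagation. The cheap probes `DSC → S` and `S → DSC` both FAIL (`bc/P0_parent.lean`, census §R1.1). -/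

/-! ## §A Candidate A — the ideal-fate split (landed by line `birth`; exact) -/

/-- Piece A.I (Case I): profiles whose IDEAL (`σ = 0`) classical developments of the reference data have bounded
density stay dilute at small `σ` (pinned data, PDE form). Verbatim the first hypothesis of the landed
`diluteSelfConsistency_of_idealFate`. Believed TRUE; classification-strength (EOS-stability of bounded-density first
singularities and of bounded global developments for EVERY such datum). -/
def CaseI : Prop :=
  ∀ η : ℝ, 0 < η → ∀ (a₀ θ₀ : T3 → ℝ) (u₀ : T3 → V3) (ha : Continuous a₀) (ha0 : ∀ x, 0 < a₀ x),
    Continuous θ₀ → Continuous u₀ → (∀ x, 0 < θ₀ x) →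
    (∃ M : ℝ, ∀ (T₁ : ℝ) (ρ₁ θ₁ : ℝ → T3 → ℝ) (u₁ : ℝ → T3 → V3), IsHardSphereEulerSolution 0 T₁ ρ₁ u₁ θ₁ →
        (∀ x, ρ₁ 0 x = a₀ x / ∫ y, a₀ y) → u₁ 0 = u₀ → θ₁ 0 = θ₀ → ∀ t ∈ Ico 0 T₁, ∀ x, ρ₁ t x ≤ M) →
    ∃ σ₀ : ℝ, 0 < σ₀ ∧ ∀ σ : ℝ, 0 < σ → σ < σ₀ →
      ∀ (T : ℝ) (ρ θ : ℝ → T3 → ℝ) (u : ℝ → T3 → V3), IsHardSphereEulerSolution σ T ρ u θ →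
        ρ 0 = rhoLim (profileOf a₀ ha ha0) σ → u 0 = u₀ → θ 0 = θ₀ →
          ∀ t ∈ Ico 0 T, ∀ x, ρ t x * σ ^ 3 < η

/-- Piece A.II (Case II): the same for profiles whose ideal developments compress WITHOUT bound (ideal implosion).
Verbatim the second hypothesis of `diluteSelfConsistency_of_idealFate`. Expected FALSE at tuned threshold profiles
(= `¬DenseExcursion` in substance: every charted DenseExcursion witness profile is Case II). -/
def CaseII : Prop :=
  ∀ η : ℝ, 0 < η → ∀ (a₀ θ₀ : T3 → ℝ) (u₀ : T3 → V3) (ha : Continuous a₀) (ha0 : ∀ x, 0 < a₀ x),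
    Continuous θ₀ → Continuous u₀ → (∀ x, 0 < θ₀ x) →
    (¬ ∃ M : ℝ, ∀ (T₁ : ℝ) (ρ₁ θ₁ : ℝ → T3 → ℝ) (u₁ : ℝ → T3 → V3), IsHardSphereEulerSolution 0 T₁ ρ₁ u₁ θ₁ →
        (∀ x, ρ₁ 0 x = a₀ x / ∫ y, a₀ y) → u₁ 0 = u₀ → θ₁ 0 = θ₀ → ∀ t ∈ Ico 0 T₁, ∀ x, ρ₁ t x ≤ M) →
    ∃ σ₀ : ℝ, 0 < σ₀ ∧ ∀ σ : ℝ, 0 < σ → σ < σ₀ →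
      ∀ (T : ℝ) (ρ θ : ℝ → T3 → ℝ) (u : ℝ → T3 → V3), IsHardSphereEulerSolution σ T ρ u θ →
        ρ 0 = rhoLim (profileOf a₀ ha ha0) σ → u 0 = u₀ → θ 0 = θ₀ →
          ∀ t ∈ Ico 0 T, ∀ x, ρ t x * σ ^ 3 < η

/-- (b) for candidate A: the assembly is LANDED (`diluteSelfConsistency_of_idealFate`, p138596) — by cases + the
de-probabilised crux; a `trivial_seam`. [folklore] -/
theorem dsc_of_caseI_caseII (hI : CaseI) (hII : CaseII) : DiluteSelfConsistency :=
  diluteSelfConsistency_of_idealFate hI hII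

/-- Candidate A is EXACT: `DSC ↔ CaseI ∧ CaseII` (landed converse). So a refutation of `CaseII` at one profile IS
`DenseExcursion` (`denseExcursion_of_not_idealFate`). [folklore] -/
theorem dsc_iff_caseI_and_caseII : DiluteSelfConsistency ↔ CaseI ∧ CaseII :=
  ⟨idealFate_of_diluteSelfConsistency, fun h => dsc_of_caseI_caseII h.1 h.2⟩

/-! ## §A′ Candidate A′ — data pinning ∧ PDE form: disqualified under (c) -/

/-- Piece A′.2: the particle-free (PDE) form of the crux. -/
def DSC_PDE : Prop :=
  ∀ η : ℝ, 0 < η → ∀ (a₀ θ₀ : T3 → ℝ) (u₀ : T3 → V3) (ha : Continuous a₀) (ha0 : ∀ x, 0 < a₀ x),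
    Continuous θ₀ → Continuous u₀ → (∀ x, 0 < θ₀ x) →
    ∃ σ₀ : ℝ, 0 < σ₀ ∧ ∀ σ : ℝ, 0 < σ → σ < σ₀ →
      ∀ (T : ℝ) (ρ θ : ℝ → T3 → ℝ) (u : ℝ → T3 → V3), IsHardSphereEulerSolution σ T ρ u θ →
        ρ 0 = rhoLim (profileOf a₀ ha ha0) σ → u 0 = u₀ → θ 0 = θ₀ →
          ∀ t ∈ Ico 0 T, ∀ x, ρ t x * σ ^ 3 < η

/-- (c) VIOLATED for candidate A′: the PDE piece is `Iff`-equivalent to the crux by a LANDED theorem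
(`diluteSelfConsistency_iff_pde`); the other piece (data pinning, `PolynomialCompressionPDE.admissible_iff_data`) is
proved. The "language switch" is a restatement, not a decomposition. [folklore] -/
theorem candidateAprime_violates_c : DSC_PDE ↔ DiluteSelfConsistency :=
  diluteSelfConsistency_iff_pde.symm

/-! ## §B Candidate B — split by TIME relative to an ideal classical development (3 pieces; glue proved) -/

/-- Piece B.0: profiles carrying NO ideal classical development on a nonempty interval are DSC-trivial (for smooth
profiles an ideal development exists — local classical existence at `σ = 0`; for non-smooth ones the pinned data
carry no classical `σ`-solution either, `stub_nonsmoothVacuous`, landed p140721). Provable-now bookkeeping. -/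
def NoIdealDevelopmentTrivial : Prop :=
  ∀ η : ℝ, 0 < η → ∀ (a₀ θ₀ : T3 → ℝ) (u₀ : T3 → V3), Continuous a₀ → Continuous θ₀ → Continuous u₀ →
    (∀ x, 0 < a₀ x) → (∀ x, 0 < θ₀ x) →
    (¬ ∃ (T₁ : ℝ) (ρ₁ θ₁ : ℝ → T3 → ℝ) (u₁ : ℝ → T3 → V3), 0 < T₁ ∧ IsHardSphereEulerSolution 0 T₁ ρ₁ u₁ θ₁ ∧
        (∀ x, ρ₁ 0 x = a₀ x / ∫ y, a₀ y) ∧ u₁ 0 = u₀ ∧ θ₁ 0 = θ₀) →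
    ∃ σ₀ : ℝ, 0 < σ₀ ∧ DiluteSelfConsistencyHoldsAt η a₀ θ₀ u₀ σ₀

/-- Piece B.1 (gen-1 strategist's `PreSingularDiluteness`, re-typed here so that this file is importable stand-alone):
dilute on `[0, T₂]` for every `T₂` short of an ideal classical lifespan, threshold `σ₀(η, profiles, T₂)`. TRUE:
proved below from the route support `EosContinuity` (stmt-12589, open, L; Kato1975 / Majda1984). -/
def PreSingularDiluteness : Prop :=
  ∀ η : ℝ, 0 < η → ∀ (a₀ θ₀ : T3 → ℝ) (u₀ : T3 → V3), Continuous a₀ → Continuous θ₀ → Continuous u₀ →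
    (∀ x, 0 < a₀ x) → (∀ x, 0 < θ₀ x) →
    ∀ (T₁ : ℝ) (ρ₁ θ₁ : ℝ → T3 → ℝ) (u₁ : ℝ → T3 → V3), IsHardSphereEulerSolution 0 T₁ ρ₁ u₁ θ₁ →
      (∀ x, ρ₁ 0 x = a₀ x / ∫ y, a₀ y) → u₁ 0 = u₀ → θ₁ 0 = θ₀ → ∀ T₂ : ℝ, 0 < T₂ → T₂ < T₁ →
      ∃ σ₀ : ℝ, 0 < σ₀ ∧ ∀ σ : ℝ, 0 < σ → σ < σ₀ →
        ∀ (T : ℝ) (ρ θ : ℝ → T3 → ℝ) (u : ℝ → T3 → V3), IsHardSphereEulerSolution σ T ρ u θ →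
          ∀ Φ : (N : ℕ) → HardSphereFlow (Torus.geometry (Fin 3)) (hsDiameter σ N) (N + 1),
            TendstoHydroFieldsAt (fun N => localGibbsLaw σ a₀ u₀ θ₀ N (Φ N)) Φ ρ u θ 0 →
              ∀ t ∈ Ico 0 T, t ≤ T₂ → ∀ x, ρ t x * σ ^ 3 < η

/-- Piece B.2 (NEW typing of gen-1's informal residual): for every ideal classical development of the reference data
on a nonempty `[0, T₁)` there are a window start `T₂ ∈ (0, T₁)` and a threshold `σ₀` such that every admissible
`σ`-solution is dilute on `(T₂, T)` — i.e. σ-uniform density control AT AND BEYOND the ideal first singularity.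
This piece is the crux localised at the singular time: at a tuned implosion profile it is exactly what the
`DenseExcursion` programme refutes numerically; no positive mechanism is on record for it. -/
def PostWindowDiluteness : Prop :=
  ∀ η : ℝ, 0 < η → ∀ (a₀ θ₀ : T3 → ℝ) (u₀ : T3 → V3), Continuous a₀ → Continuous θ₀ → Continuous u₀ →
    (∀ x, 0 < a₀ x) → (∀ x, 0 < θ₀ x) →
    ∀ (T₁ : ℝ) (ρ₁ θ₁ : ℝ → T3 → ℝ) (u₁ : ℝ → T3 → V3), 0 < T₁ → IsHardSphereEulerSolution 0 T₁ ρ₁ u₁ θ₁ →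
      (∀ x, ρ₁ 0 x = a₀ x / ∫ y, a₀ y) → u₁ 0 = u₀ → θ₁ 0 = θ₀ →
      ∃ T₂ : ℝ, 0 < T₂ ∧ T₂ < T₁ ∧ ∃ σ₀ : ℝ, 0 < σ₀ ∧ ∀ σ : ℝ, 0 < σ → σ < σ₀ →
        ∀ (T : ℝ) (ρ θ : ℝ → T3 → ℝ) (u : ℝ → T3 → V3), IsHardSphereEulerSolution σ T ρ u θ →
          ∀ Φ : (N : ℕ) → HardSphereFlow (Torus.geometry (Fin 3)) (hsDiameter σ N) (N + 1),
            TendstoHydroFieldsAt (fun N => localGibbsLaw σ a₀ u₀ θ₀ N (Φ N)) Φ ρ u θ 0 →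
              ∀ t ∈ Ico 0 T, T₂ < t → ∀ x, ρ t x * σ ^ 3 < η

/-- (b) for candidate B: **`B.0 → B.1 → B.2 → DSC`** (pure logic: pick an ideal development if there is one, take
B.2's window start `T₂` and threshold, B.1's threshold for `[0, T₂]`, and the minimum). [folklore] -/
theorem dsc_of_timeSplit (h0 : NoIdealDevelopmentTrivial) (h1 : PreSingularDiluteness)
    (h2 : PostWindowDiluteness) : DiluteSelfConsistency := by
  intro η hη a₀ θ₀ u₀ ha hθ hu ha0 hθ0
  by_cases hdev : ∃ (T₁ : ℝ) (ρ₁ θ₁ : ℝ → T3 → ℝ) (u₁ : ℝ → T3 → V3), 0 < T₁ ∧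
      IsHardSphereEulerSolution 0 T₁ ρ₁ u₁ θ₁ ∧ (∀ x, ρ₁ 0 x = a₀ x / ∫ y, a₀ y) ∧ u₁ 0 = u₀ ∧ θ₁ 0 = θ₀
  · obtain ⟨T₁, ρ₁, θ₁, u₁, hT₁, hsol, hd, hu0, hθ0'⟩ := hdev
    obtain ⟨T₂, hT₂, hT₂1, σ₂, hσ₂, H2⟩ :=
      h2 η hη a₀ θ₀ u₀ ha hθ hu ha0 hθ0 T₁ ρ₁ θ₁ u₁ hT₁ hsol hd hu0 hθ0'
    obtain ⟨σ₁, hσ₁, H1⟩ := h1 η hη a₀ θ₀ u₀ ha hθ hu ha0 hθ0 T₁ ρ₁ θ₁ u₁ hsol hd hu0 hθ0' T₂ hT₂ hT₂1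
    refine ⟨min σ₁ σ₂, lt_min hσ₁ hσ₂, ?_⟩
    intro σ hσ hσlt T ρ θ u hE Φ htie t ht x
    by_cases htT : t ≤ T₂
    · exact H1 σ hσ (lt_of_lt_of_le hσlt (min_le_left _ _)) T ρ θ u hE Φ htie t ht htT x
    · exact H2 σ hσ (lt_of_lt_of_le hσlt (min_le_right _ _)) T ρ θ u hE Φ htie t ht (lt_of_not_ge htT) x
  · exact h0 η hη a₀ θ₀ u₀ ha hθ hu ha0 hθ0 hdev

/-- (d) for piece B.1: it HAS a plan — it is a THEOREM from the route support `EosContinuity` (stmt-12589; verbatim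
the gen-1 strategist's `preSingularDiluteness_of_eosContinuity`, re-proved here against this file's copy of the def):
sup of the ideal density on the compact slab `[0,T₂] × 𝕋³`, EOS continuity with tolerance `1`, `(C+1)σ³ < η` once
`σ < min(1, η/(C+1))`, and the one-flow tie is the all-flow tie (`tendstoHydroFieldsAt_zero_transfer`).
[cite: Kato1975] [cite: Majda1984] -/
theorem preSingularDiluteness_of_eosContinuity (hE : EosContinuity) : PreSingularDiluteness := by
  intro η hη a₀ θ₀ u₀ ha hθ hu ha0 hθ0 T₁ ρ₁ θ₁ u₁ hsol h0 hu0 hθ₀ T₂ hT₂ hT₂1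
  obtain ⟨C, hC⟩ := hsol.smooth_density.exists_norm_le_of_isCompact isCompact_Icc
    (fun t ht => ⟨ht.1, lt_of_le_of_lt ht.2 hT₂1⟩)
  have hC0 : 0 ≤ C := le_trans (norm_nonneg _) (hC 0 ⟨le_rfl, hT₂.le⟩ 0)
  obtain ⟨σ₁, hσ₁, H⟩ := hE a₀ θ₀ u₀ ha hθ hu ha0 hθ0 T₁ ρ₁ θ₁ u₁ hsol h0 hu0 hθ₀ T₂ hT₂ hT₂1 1 one_pos
  refine ⟨min σ₁ (min 1 (η / (C + 1))), lt_min hσ₁ (lt_min one_pos (div_pos hη (by linarith))), ?_⟩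
  intro σ hσ hσlt T ρ θ u hsolσ Φ htie t ht htT₂ x
  have hσ₁' : σ < σ₁ := lt_of_lt_of_le hσlt (min_le_left _ _)
  have hσ1 : σ < 1 := lt_of_lt_of_le hσlt ((min_le_right _ _).trans (min_le_left _ _))
  have hση : σ < η / (C + 1) := lt_of_lt_of_le hσlt ((min_le_right _ _).trans (min_le_right _ _))
  have hclose := (H σ hσ hσ₁').2 T ρ θ u hsolσ (fun Ψ => tendstoHydroFieldsAt_zero_transfer Φ Ψ htie)
    t ht htT₂ x
  have hρ₁ : ρ₁ t x ≤ C := le_trans (Real.le_norm_self _) (hC t ⟨ht.1, htT₂⟩ x)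
  have hρ : ρ t x < C + 1 := by
    have := (abs_lt.1 hclose).2
    linarith
  have hσ3 : σ ^ 3 ≤ σ := by
    have h1 : σ ^ 3 ≤ σ ^ 1 := pow_le_pow_of_le_one hσ.le hσ1.le (by norm_num)
    simpa using h1
  have hC1 : 0 < C + 1 := by linarith
  have hρpos : 0 < ρ t x := hsolσ.density_pos t ht x
  calc ρ t x * σ ^ 3 ≤ ρ t x * σ := mul_le_mul_of_nonneg_left hσ3 hρpos.le
    _ < (C + 1) * (η / (C + 1)) := mul_lt_mul'' hρ hση hρpos.le hσ.le
    _ = η := by field_simp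

/-- Candidate B is EXACT on pieces B.1 and B.2 (both are consequences of the crux: restrictions of its conclusion to
sub-windows; B.2 with `T₂ := T₁/2`). So B.2, like CaseII, is refuted by every `DenseExcursion` witness whose ideal
development lives past the excursion time — i.e. by the tuned implosions of the record. [folklore] -/
theorem preSingular_and_postWindow_of_dsc (h : DiluteSelfConsistency) :
    PreSingularDiluteness ∧ PostWindowDiluteness := by
  refine ⟨fun η hη a₀ θ₀ u₀ ha hθ hu ha0 hθ0 T₁ ρ₁ θ₁ u₁ _ _ _ _ T₂ _ _ => ?_,
    fun η hη a₀ θ₀ u₀ ha hθ hu ha0 hθ0 T₁ ρ₁ θ₁ u₁ hT₁ _ _ _ _ => ?_⟩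
  · obtain ⟨σ₀, hσ₀, H⟩ := h η hη a₀ θ₀ u₀ ha hθ hu ha0 hθ0
    exact ⟨σ₀, hσ₀, fun σ hσ hσlt T ρ θ u hE Φ htie t ht _ x => H σ hσ hσlt T ρ θ u hE Φ htie t ht x⟩
  · obtain ⟨σ₀, hσ₀, H⟩ := h η hη a₀ θ₀ u₀ ha hθ hu ha0 hθ0
    exact ⟨T₁ / 2, by linarith, by linarith, σ₀, hσ₀,
      fun σ hσ hσlt T ρ θ u hE Φ htie t ht _ x => H σ hσ hσlt T ρ θ u hE Φ htie t ht x⟩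

/-! ## §E Candidate E — bridge through the sibling crux: disqualified under (c) -/

/-- (c) VIOLATED for candidate E (`T ∧ (T → DSC)` with `T := ¬DenseExcursion`): `T ↔ DSC` is LANDED, so the bridge is
the crux again (and `k = 1` in substance: RULE-N). [folklore] -/
theorem candidateE_violates_c : ¬ DenseExcursion ↔ DiluteSelfConsistency :=
  not_denseExcursion_iff_diluteSelfConsistency

/-- …and candidate F (`T := ¬PolynomialCompression`, glue `DiluteOfNotPolynomialCompression` proved) has a REFUTED
`T`: `PolynomialCompression` is PROVED (`polynomialCompression_proof`). [folklore] -/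
theorem candidateF_piece_refuted : ¬ ¬ PolynomialCompression := fun h => h polynomialCompression_proof

/-! ## §G Candidate G — level bootstrap (bridge with an open, DSC-implied `T`) -/

/-- Piece G.1: SOME positive packing level is never reached (profile-wise threshold). A consequence of the crux
(take any level); open on its own; at levels above the equation-of-state wall it is a statics/EOS question, at small
levels it is the crux's own decision. -/
def SomeLevelNeverReached : Prop :=
  ∃ η₁ : ℝ, 0 < η₁ ∧ ∀ (a₀ θ₀ : T3 → ℝ) (u₀ : T3 → V3), Continuous a₀ → Continuous θ₀ → Continuous u₀ →
    (∀ x, 0 < a₀ x) → (∀ x, 0 < θ₀ x) → ∃ σ₀ : ℝ, 0 < σ₀ ∧ DiluteSelfConsistencyHoldsAt η₁ a₀ θ₀ u₀ σ₀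

/-- Piece G.2: the bootstrap from one level to every level. No mechanism on record ("packing < η₁ ⇒ packing → 0" is
false along a tuned implosion that shocks at an intermediate packing); expected FALSE with the crux. -/
def LevelBootstrap : Prop := SomeLevelNeverReached → DiluteSelfConsistency

/-- (b) for candidate G: modus ponens (`trivial_seam`). [folklore] -/
theorem dsc_of_levelSplit (h1 : SomeLevelNeverReached) (h2 : LevelBootstrap) : DiluteSelfConsistency := h2 h1

/-- G.1 is implied by the crux (so the split is exact and G.2 carries the whole content). [folklore] -/
theorem someLevelNeverReached_of_dsc (h : DiluteSelfConsistency) : SomeLevelNeverReached :=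
  ⟨1, one_pos, fun a₀ θ₀ u₀ ha hθ hu ha0 hθ0 => h 1 one_pos a₀ θ₀ u₀ ha hθ hu ha0 hθ0⟩

end Summit.AtomisticToContinuum.HydrodynamicLimit.Cruxes.DiluteSelfConsistency.StrategistR1

end
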